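import Literature.Analysis.FluidPDE.QuasiSteadyCore
import Literature.Analysis.FluidPDE.LerayProfileRegularity
import Literature.Analysis.FluidPDE.TsaiHeadPressure
import HarnessLib

/-!
# Route GaldiLiouvilleGate — the frozen-core steady limit (item stmt-NavierStokesRegularity-0925)

**Frozen-core lemma, limit step.** Let `(u, p)` be a classical solution of the unforced
Navier–Stokes system with viscosity `ν` on `[0, T) × E` and let `(t_k, ξ_k, λ_k)` be a
*quasi-steady core sequence* for `u` (`Literature.Analysis.FluidPDE.IsQuasiSteadyCoreSequence`:
uniform `C³` bounds of the core profiles `V_k(s, y) = λ_k u(t_k + λ_k² s, ξ_k + λ_k y)` on the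
parabolic windows `[-A, 0] × B̄(0, A)`, explicit quasi-steadiness `sup ‖∂_s V_k‖ → 0` there, the
normalisation `λ_k ‖u(t_k, ξ_k)‖ = 1` and the core Reynolds bound `λ_k ‖u(t_k, ·)‖ ≤ M ν`). Then
along a subsequence the core slices `V_k(0, ·)` converge in `C²_loc`, and the space–time cores
converge on every window, to an `s`-independent field `U` which is a **steady** solution of
Navier–Stokes with the SAME viscosity: there is a `C¹` pressure `P` with
`IsLerayProfile ν 0 U P` (`−νΔU + (U·∇)U + ∇P = 0`, `div U = 0`), `‖U 0‖ = 1` (so `U ≢ 0`),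
`‖U‖ ≤ M ν`; the core pressure gradients converge locally uniformly to `∇P`; on `ℝ³`, `U` and `P`
are `C^∞` (the tree's steady bootstrap `IsLerayProfile.contDiff_velocity_infty`,
`IsLerayProfile.contDiff_pressure_of_smooth`), and under a bounded Dirichlet share
(`HasBoundedDirichletShare`: `sup_k λ_k ∫ |∇u(t_k)|² < ∞`) the limit has finite Dirichlet integral
`∫ |∇U|² ≤ liminf` (Fatou), i.e. it is a `D`-solution candidate for Galdi's Liouville problem
(route decl `GaldiLiouville`), short of the decay `U → 0` at infinity, which does NOT follow from
core-window hypotheses.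

## Proof

The compactness step is the definition file's
`IsQuasiSteadyCoreSequence.exists_strictMono_tendstoUniformlyOn` (Arzelà–Ascoli + Landau). The
cores `(V_k, Π_k)` are classical solutions on the zoomed intervals
(`IsQuasiSteadyCoreSequence.isClassicalNSSolutionOn_coreProfile`), which eventually contain the
window `[-1, 0]`, so at the interior time `s = 0` the momentum equation reads
`∇Π_k(0) = νΔV_k(0) − (V_k(0)·∇)V_k(0) − ∂_sV_k(0)`. Along the subsequence the right side converges
uniformly on balls to `F := νΔU − (U·∇)U` (second derivatives converge; the convective term is
bilinear with bounded factors; `∂_sV_k → 0` by quasi-steadiness). Hence the normalised potentials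
`π_k := Π_k(0, ·) − Π_k(0, 0)` have uniformly convergent gradients, are uniformly Cauchy on balls
(mean value inequality, Mathlib `uniformCauchySeqOn_ball_of_fderiv`), converge to some `P`, and
`∇P = F` with `P ∈ C¹` (the derivative of the limit is the limit of the derivatives).
Incompressibility passes to the limit pointwise. Passing to the limit in the equation is exactly
the step the definition file leaves "to the user of the definition (route item stmt-0925)".

## References

* G. Koch, N. Nadirashvili, G. Seregin, V. Šverák, Acta Math. 203 (2009) = arXiv:0709.3599, §6,
  (6.2)–(6.3), Prop. 6.1 (the zoom variables).
* H. Matano, F. Merle, Comm. Pure Appl. Math. 57 (2004) 1494–1541 (quasi-static rescaled steady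
  states: the frozen-core paradigm).
* G. P. Galdi, *An Introduction to the Mathematical Theory of the Navier–Stokes Equations*,
  2nd ed. (2011), Rem. X.9.4 (Liouville problem for `D`-solutions).
-/

noncomputable section

-- the summit-side namespace `Summit.NavierStokesRegularity.NavierStokesRegularity.…` repeats a
-- component by design (D-0017)
set_option linter.dupNamespace false

open Literature.Analysis.FluidPDE MeasureTheory Set Function Filter Topology Metric
open scoped ENNReal NNReal InnerProductSpace RealInnerProductSpace Laplacian

namespace Summit.NavierStokesRegularity.NavierStokesRegularity.Theorems

section General

variable {E : Type*} [NormedAddCommGroup E] [InnerProductSpace ℝ E] [FiniteDimensional ℝ E]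

omit [FiniteDimensional ℝ E] in
/-- Uniform convergence of bilinear evaluations `y ↦ F_j(y)[f_j(y)]` on a set where the vector
factors `f_j` are uniformly bounded and the limit operator field `G` is bounded: if `F_j → G` and
`f_j → g` uniformly on `s`, then `F_j[f_j] → G[g]` uniformly on `s` (used for the convective term
`(V·∇)V = DV[V]`). [folklore] -/
theorem frozenCore_tendstoUniformlyOn_clm_apply {F : ℕ → E → E →L[ℝ] E} {G : E → E →L[ℝ] E}
    {f : ℕ → E → E} {g : E → E} {s : Set E} {B C : ℝ}
    (hF : TendstoUniformlyOn F G atTop s) (hf : TendstoUniformlyOn f g atTop s)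
    (hfB : ∀ j, ∀ y ∈ s, ‖f j y‖ ≤ B) (hGC : ∀ y ∈ s, ‖G y‖ ≤ C) :
    TendstoUniformlyOn (fun j y => F j y (f j y)) (fun y => G y (g y)) atTop s := by
  rw [Metric.tendstoUniformlyOn_iff] at hF hf ⊢
  intro ε hε
  have hB1 : 0 < |B| + 1 := by positivity
  have hC1 : 0 < |C| + 1 := by positivity
  filter_upwards [hF (ε / (2 * (|B| + 1))) (by positivity),
    hf (ε / (2 * (|C| + 1))) (by positivity)] with j hFj hfj y hy
  have h1 := hFj y hy
  have h2 := hfj y hy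
  rw [dist_eq_norm] at h1 h2 ⊢
  have e : G y (g y) - F j y (f j y) = G y (g y - f j y) + (G y - F j y) (f j y) := by
    simp only [map_sub, sub_apply]; abel
  rw [e]
  calc ‖G y (g y - f j y) + (G y - F j y) (f j y)‖
      ≤ ‖G y‖ * ‖g y - f j y‖ + ‖G y - F j y‖ * ‖f j y‖ :=
        (norm_add_le _ _).trans (add_le_add (ContinuousLinearMap.le_opNorm _ _)
          (ContinuousLinearMap.le_opNorm _ _))
    _ ≤ (|C| + 1) * ‖g y - f j y‖ + ‖G y - F j y‖ * (|B| + 1) := by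
        gcongr
        · exact (hGC y hy).trans ((le_abs_self C).trans (lt_add_one _).le)
        · exact (hfB j y hy).trans ((le_abs_self B).trans (lt_add_one _).le)
    _ < (|C| + 1) * (ε / (2 * (|C| + 1))) + ε / (2 * (|B| + 1)) * (|B| + 1) :=
        add_lt_add (mul_lt_mul_of_pos_left h2 hC1) (mul_lt_mul_of_pos_right h1 hB1)
    _ = ε := by field_simp; ring

/-- Uniform convergence of second derivatives gives uniform convergence of (multiples of) the
Laplacians: `νΔf = Λ(D²f)` for the continuous linear map `Λ(L) = ν ∑ᵢ L[bᵢ, bᵢ]` over an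
orthonormal basis, and continuous linear maps are uniformly continuous. [folklore] -/
theorem frozenCore_tendstoUniformlyOn_laplacian {F' : Type*} [NormedAddCommGroup F']
    [NormedSpace ℝ F'] {f : ℕ → E → F'} {g : E → F'} {s : Set E} (ν : ℝ)
    (h2 : TendstoUniformlyOn (fun j => fderiv ℝ (fderiv ℝ (f j))) (fderiv ℝ (fderiv ℝ g)) atTop s) :
    TendstoUniformlyOn (fun j y => ν • (Δ (f j)) y) (fun y => ν • (Δ g) y) atTop s := by
  set b := stdOrthonormalBasis ℝ E with hb
  set Λ : (E →L[ℝ] E →L[ℝ] F') →L[ℝ] F' :=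
    ν • ∑ i, (ContinuousLinearMap.apply ℝ F' (b i)).comp
      (ContinuousLinearMap.apply ℝ (E →L[ℝ] F') (b i)) with hΛ
  have hΔ : ∀ (φ : E → F') (y : E), ν • (Δ φ) y = Λ (fderiv ℝ (fderiv ℝ φ) y) := fun φ y => by
    rw [InnerProductSpace.laplacian_eq_iteratedFDeriv_orthonormalBasis φ b]
    simp only [hΛ, iteratedFDeriv_two_apply, Matrix.cons_val_zero, Matrix.cons_val_one,
      Matrix.cons_val_fin_one, FunLike.coe_smul, Pi.smul_apply,
      FunLike.coe_sum, Finset.sum_apply,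
      ContinuousLinearMap.comp_apply, ContinuousLinearMap.apply_apply]
  have h := Λ.uniformContinuous.comp_tendstoUniformlyOn h2
  refine (h.congr (Eventually.of_forall fun j y _ => ?_)).congr_right fun y _ => ?_
  · simp only [Function.comp_apply, hΔ]
  · simp only [Function.comp_apply, hΔ]

/-- **The frozen-core steady limit** (general finite-dimensional space). For a classical solution
`(u, p)` of the unforced Navier–Stokes system with viscosity `ν` on `[0, T) × E` and a quasi-steady
core sequence `(t_k, ξ_k, λ_k)` (`IsQuasiSteadyCoreSequence ν T u t ξ lam M`), there are a
subsequence `φ`, a `C²` field `U` and a `C¹` pressure `P` such that `(U, P)` is a STEADY solution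
with the same viscosity (`IsLerayProfile ν 0 U P`: `−νΔU + (U·∇)U + ∇P = 0`, `div U = 0`),
`‖U 0‖ = 1`, `‖U‖ ≤ M ν`, the core slices `V_{φ j}(0, ·)` converge to `U` uniformly on balls with
their first derivatives, the space–time cores converge to `(s, y) ↦ U y` uniformly on every window
`[-A, 0] × B̄(0, A)`, and the core pressure gradients `∇Π_{φ j}(0, ·)` converge to `∇P` uniformly
on balls. (KNSS 2009 zoom variables; Matano–Merle frozen-core paradigm; proof in the module
docstring.) [folklore] -/
theorem frozenCore_exists_steady_limit {ν T M : ℝ} {u : ℝ → E → E} {p : ℝ → E → ℝ}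
    {t : ℕ → ℝ} {ξ : ℕ → E} {lam : ℕ → ℝ}
    (hu : IsClassicalNSSolutionOn (Ico 0 T) ν 0 u p)
    (h : IsQuasiSteadyCoreSequence ν T u t ξ lam M) :
    ∃ φ : ℕ → ℕ, StrictMono φ ∧ ∃ (U : E → E) (P : E → ℝ), IsLerayProfile ν 0 U P ∧ ‖U 0‖ = 1 ∧
      (∀ y, ‖U y‖ ≤ M * ν) ∧
      (∀ A : ℝ, TendstoUniformlyOn
        (fun j => coreProfile u (t (φ j)) (ξ (φ j)) (lam (φ j)) 0) U atTop (closedBall 0 A)) ∧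
      (∀ A : ℝ, TendstoUniformlyOn
        (fun j => fderiv ℝ (coreProfile u (t (φ j)) (ξ (φ j)) (lam (φ j)) 0)) (fderiv ℝ U) atTop
        (closedBall 0 A)) ∧
      (∀ A : ℝ, TendstoUniformlyOn
        (fun j => uncurry (coreProfile u (t (φ j)) (ξ (φ j)) (lam (φ j))))
        (fun z => U z.2) atTop (Icc (-A) 0 ×ˢ closedBall 0 A)) ∧
      (∀ A : ℝ, TendstoUniformlyOn
        (fun j => gradient (corePressure p (t (φ j)) (ξ (φ j)) (lam (φ j)) 0)) (gradient P) atTop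
        (closedBall 0 A)) := by
  obtain ⟨φ, hφ, U, hUC, hU0, hUb, hc0, hc1, hc2, hst⟩ := h.exists_strictMono_tendstoUniformlyOn
  have hφt : Tendsto φ atTop atTop := hφ.tendsto_atTop
  -- notation: cores, core pressures, extracted slices
  set V : ℕ → ℝ → E → E := fun k => coreProfile u (t k) (ξ k) (lam k) with hV
  set Q : ℕ → ℝ → E → ℝ := fun k => corePressure p (t k) (ξ k) (lam k) with hQ
  set f : ℕ → E → E := fun j => V (φ j) 0 with hf
  -- the cores are classical solutions on the zoomed intervals, which eventually contain `s = 0`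
  have hcl : ∀ k, IsClassicalNSSolutionOn (Ioo (-(t k / lam k ^ 2)) ((T - t k) / lam k ^ 2)) ν 0
      (V k) (Q k) := fun k => h.isClassicalNSSolutionOn_coreProfile hu k
  have hev0 : ∀ᶠ k in atTop, (0 : ℝ) ∈ Ioo (-(t k / lam k ^ 2)) ((T - t k) / lam k ^ 2) := by
    filter_upwards [h.eventually_Icc_subset_Ioo one_pos] with k hk using hk ⟨by norm_num, le_rfl⟩
  -- the momentum equation at `s = 0`, solved for the pressure gradient
  have hmom : ∀ᶠ k in atTop, ∀ y, gradient (Q k 0) y =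
      ν • (Δ (V k 0)) y - convect (V k 0) (V k 0) y - timeDeriv (V k) 0 y := by
    filter_upwards [hev0] with k hk y
    have hm := (hcl k).momentum 0 hk y
    rw [timeDerivWithin_of_mem_interior (by rwa [interior_Ioo]) y] at hm
    simp only [Pi.zero_apply, add_zero] at hm
    have h3 : ν • (Δ (V k 0)) y =
        timeDeriv (V k) 0 y + convect (V k 0) (V k 0) y + gradient (Q k 0) y := by
      rw [hm]; abel
    rw [h3]; abel
  -- incompressibility at `s = 0`
  have hdiv : ∀ᶠ k in atTop, ∀ y, VectorCalculus.divergence (V k 0) y = 0 := by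
    filter_upwards [hev0] with k hk y using (hcl k).divFree 0 hk y
  -- (1) the right-hand sides converge uniformly on balls along `φ`
  have hlap : ∀ A : ℝ, TendstoUniformlyOn (fun j y => ν • (Δ (f j)) y) (fun y => ν • (Δ U) y)
      atTop (closedBall 0 A) := fun A => frozenCore_tendstoUniformlyOn_laplacian ν (hc2 A)
  have hconv : ∀ A : ℝ, TendstoUniformlyOn (fun j y => convect (f j) (f j) y)
      (fun y => convect U U y) atTop (closedBall 0 A) := fun A => by
    obtain ⟨C, hC⟩ := (isCompact_closedBall (0 : E) A).exists_bound_of_continuousOn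
      ((hUC.continuous_fderiv two_ne_zero).continuousOn)
    simp only [convect_apply]
    exact frozenCore_tendstoUniformlyOn_clm_apply (hc1 A) (hc0 A)
      (fun j y _ => h.norm_coreProfile_zero_le (φ j) y) hC
  have htime : ∀ A : ℝ, TendstoUniformlyOn (fun j y => timeDeriv (V (φ j)) 0 y) (fun _ => 0)
      atTop (closedBall 0 A) := fun A => by
    refine Metric.tendstoUniformlyOn_iff.2 fun ε hε => ?_
    have hA : 0 < |A| + 1 := by positivity
    filter_upwards [hφt.eventually (h.quasiSteady (|A| + 1) hA (ε / 2) (half_pos hε))]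
      with j hj y hy
    rw [dist_comm, dist_zero_right]
    refine (hj 0 ⟨by linarith [abs_nonneg A], le_rfl⟩ y ?_).trans_lt (half_lt_self hε)
    exact closedBall_subset_closedBall ((le_abs_self A).trans (lt_add_one _).le) hy
  set Fl : E → E := fun y => ν • (Δ U) y - convect U U y with hFl
  have hgradQ : ∀ A : ℝ, TendstoUniformlyOn (fun j => gradient (Q (φ j) 0)) Fl atTop
      (closedBall 0 A) := fun A => by
    have h1 := ((hlap A).sub (hconv A)).sub (htime A)
    refine (h1.congr ?_).congr_right fun y _ => ?_
    · filter_upwards [hφt.eventually hmom] with j hj y _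
      simp only [Pi.sub_apply]
      exact (hj y).symm
    · simp only [Pi.sub_apply, sub_zero, hFl]
  -- (2) the core pressure slices are differentiable (all `k`)
  have hQd : ∀ k, Differentiable ℝ (Q k 0) := fun k => by
    have e : Q k 0 = fun y => lam k ^ 2 * p (t k) (ξ k + lam k • y) := by
      funext y; simp only [hQ, corePressure_apply, mul_zero, add_zero]
    rw [e]
    exact (differentiable_const _).mul
      (((hu.contDiff_pressure (h.time_mem k)).differentiable (by simp)).comp
        ((differentiable_const _).add ((differentiable_const _).smul differentiable_id)))
  -- (3) normalised potentials, their derivatives, and the uniform limit of the derivatives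
  set π : ℕ → E → ℝ := fun j y => Q (φ j) 0 y - Q (φ j) 0 0 with hπ
  have hπd : ∀ j y, HasFDerivAt (π j) (fderiv ℝ (Q (φ j) 0) y) y := fun j y =>
    ((hQd (φ j) y).hasFDerivAt).sub_const _
  have hπf : ∀ j, fderiv ℝ (π j) = fderiv ℝ (Q (φ j) 0) := fun j => funext fun y => (hπd j y).fderiv
  set W : E → E →L[ℝ] ℝ := fun y => InnerProductSpace.toDual ℝ E (Fl y) with hW
  have hWconv : ∀ A : ℝ, TendstoUniformlyOn (fun j => fderiv ℝ (Q (φ j) 0)) W atTop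
      (closedBall 0 A) := fun A => by
    have h1 := (InnerProductSpace.toDual ℝ E).isometry.uniformContinuous.comp_tendstoUniformlyOn
      (hgradQ A)
    refine h1.congr (Eventually.of_forall fun j y _ => ?_)
    simp only [Function.comp_apply, gradient, LinearIsometryEquiv.apply_symm_apply]
  -- (4) the potentials are uniformly Cauchy on balls, hence converge to some `P`
  have hπC : ∀ n : ℕ, UniformCauchySeqOn π atTop (ball (0 : E) ((n : ℝ) + 1)) := fun n => by
    refine uniformCauchySeqOn_ball_of_fderiv (f' := fun j => fderiv ℝ (Q (φ j) 0)) ?_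
      (fun j y _ => hπd j y) ?_
    · exact ((hWconv ((n : ℝ) + 1)).mono ball_subset_closedBall).uniformCauchySeqOn
    · have e : (fun j => π j 0) = fun _ => (0 : ℝ) := funext fun j => by simp only [hπ, sub_self]
      rw [e]
      exact tendsto_const_nhds.cauchy_map
  obtain ⟨P, hP⟩ := exists_tendstoUniformlyOn_of_uniformCauchySeqOn_ball hπC
  -- (5) `∇P = F`, `P ∈ C¹`
  have hPd : ∀ y, HasFDerivAt P (W y) y := fun y => by
    obtain ⟨n, hn⟩ := exists_nat_gt ‖y‖
    have hyb : y ∈ ball (0 : E) ((n : ℝ) + 1) := by rw [mem_ball_zero_iff]; linarith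
    refine hasFDerivAt_of_tendstoUniformlyOn_ball (F := π)
      (Eventually.of_forall fun j z _ => (hπd j z).differentiableAt)
      (fun z hz => (hP n).tendsto_at hz) ?_ hyb
    rw [show (fun j => fderiv ℝ (π j)) = fun j => fderiv ℝ (Q (φ j) 0) from funext hπf]
    exact (hWconv ((n : ℝ) + 1)).mono ball_subset_closedBall
  have hPgrad : ∀ y, gradient P y = Fl y := fun y => by
    rw [gradient, (hPd y).fderiv, hW]
    simp only [LinearIsometryEquiv.symm_apply_apply]
  have hΔc : Continuous (Δ U) := by
    rw [InnerProductSpace.laplacian_eq_iteratedFDeriv_orthonormalBasis U (stdOrthonormalBasis ℝ E)]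
    exact continuous_finsetSum _ fun i _ =>
      (continuous_eval_const _).comp (hUC.continuous_iteratedFDeriv le_rfl)
  have hFlc : Continuous Fl :=
    (hΔc.const_smul ν).sub ((hUC.continuous_fderiv two_ne_zero).clm_apply hUC.continuous)
  have hPC : ContDiff ℝ 1 P :=
    contDiff_one_iff_hasFDerivAt.2 ⟨W, (InnerProductSpace.toDual ℝ E).continuous.comp hFlc, hPd⟩
  -- (6) incompressibility passes to the limit
  set b := stdOrthonormalBasis ℝ E with hb
  have hdivc : Continuous fun L : E →L[ℝ] E => ∑ i, ⟪b i, L (b i)⟫_ℝ :=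
    continuous_finsetSum _ fun i _ =>
      continuous_const.inner (ContinuousLinearMap.apply ℝ E (b i)).continuous
  have hdivU : VectorCalculus.IsDivFree U := fun y => by
    have h1 : Tendsto (fun j => VectorCalculus.divergence (f j) y) atTop
        (𝓝 (VectorCalculus.divergence U y)) := by
      have hy : y ∈ closedBall (0 : E) ‖y‖ := mem_closedBall_zero_iff.2 le_rfl
      have h2 := (hdivc.tendsto _).comp ((hc1 ‖y‖).tendsto_at hy)
      simp only [Function.comp_def, ← divergence_eq_sum_inner_fderiv b] at h2
      exact h2
    have h2 : (fun j => VectorCalculus.divergence (f j) y) =ᶠ[atTop] fun _ => (0 : ℝ) := by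
      filter_upwards [hφt.eventually hdiv] with j hj using hj y
    exact tendsto_nhds_unique_of_eventuallyEq h1 tendsto_const_nhds h2
  -- (7) the steady system
  have hprof : IsLerayProfile ν 0 U P :=
    { contDiff_velocity := hUC
      contDiff_pressure := hPC
      profile_eq := fun y => by
        rw [hPgrad y]
        simp only [hFl, zero_smul, add_zero]
        abel
      divFree := hdivU }
  exact ⟨φ, hφ, U, P, hprof, hU0, hUb, hc0, hc1, hst,
    fun A => (hgradQ A).congr_right fun y _ => (hPgrad y).symm⟩


end General

section Dirichlet

variable {E : Type*} [NormedAddCommGroup E] [InnerProductSpace ℝ E] [FiniteDimensional ℝ E]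
  [MeasurableSpace E] [BorelSpace E]

/-- **Lower semicontinuity of the Dirichlet integral** along pointwise convergent gradients
(Fatou): if `D(g_j)(y) → DU(y)` for every `y` and `∫ |∇g_j|² ≤ D` for all `j`, then
`∫ |∇U|² ≤ D`. This is the "`∫_{B_A} |∇U_*|² ≤ liminf` (dissipation share)" clause of the
frozen-core lemma. [folklore] -/
theorem frozenCore_lintegral_frobeniusNormSq_le_of_tendsto {g : ℕ → E → E} {U : E → E}
    {D : ℝ≥0∞} (hconv : ∀ y, Tendsto (fun j => fderiv ℝ (g j) y) atTop (𝓝 (fderiv ℝ U y)))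
    (hD : ∀ j, ∫⁻ y, ENNReal.ofReal (frobeniusNormSq (fderiv ℝ (g j) y)) ≤ D) :
    ∫⁻ y, ENNReal.ofReal (frobeniusNormSq (fderiv ℝ U y)) ≤ D := by
  have hFc : Continuous fun L : E →L[ℝ] E => frobeniusNormSq L := by
    unfold frobeniusNormSq
    exact continuous_finsetSum _ fun i _ =>
      ((ContinuousLinearMap.apply ℝ E _).continuous.norm).pow 2
  have hpt : ∀ y, Tendsto (fun j => ENNReal.ofReal (frobeniusNormSq (fderiv ℝ (g j) y))) atTop
      (𝓝 (ENNReal.ofReal (frobeniusNormSq (fderiv ℝ U y)))) := fun y =>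
    (ENNReal.continuous_ofReal.tendsto _).comp ((hFc.tendsto _).comp (hconv y))
  have hmeas : ∀ j,
      AEMeasurable (fun y => ENNReal.ofReal (frobeniusNormSq (fderiv ℝ (g j) y))) volume :=
    fun j => (ENNReal.measurable_ofReal.comp
      (hFc.measurable.comp (measurable_fderiv ℝ (g j)))).aemeasurable
  calc ∫⁻ y, ENNReal.ofReal (frobeniusNormSq (fderiv ℝ U y))
      = ∫⁻ y, liminf (fun j => ENNReal.ofReal (frobeniusNormSq (fderiv ℝ (g j) y))) atTop :=
        lintegral_congr fun y => ((hpt y).liminf_eq).symm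
    _ ≤ liminf (fun j => ∫⁻ y, ENNReal.ofReal (frobeniusNormSq (fderiv ℝ (g j) y))) atTop :=
        lintegral_liminf_le' hmeas
    _ ≤ D := liminf_le_of_frequently_le' (Eventually.of_forall hD).frequently

end Dirichlet

section SpaceDimThree

/-- **Frozen-core steady limit on `ℝ³`** (the typed frozen-core lemma of item
stmt-NavierStokesRegularity-0925, robust part). For a classical solution `(u, p)` of Navier–Stokes
with viscosity `ν > 0` on `[0, T) × ℝ³` and a quasi-steady core sequence
(`IsQuasiSteadyCoreSequence ν T u t ξ lam M`), along a subsequence the cores freeze onto a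
NONTRIVIAL BOUNDED SMOOTH STEADY Navier–Stokes flow with the same viscosity: there are `U`, `P`,
both `C^∞`, with `IsLerayProfile ν 0 U P`, `‖U 0‖ = 1`, `‖U‖ ≤ M ν`, the stated local uniform
convergences (slices with gradients on balls, space–time cores on windows, core pressure gradients
on balls), and, under a bounded Dirichlet share of the cores (`HasBoundedDirichletShare u t lam`,
`sup_k λ_k ∫ |∇u(t_k)|² < ∞`), a finite Dirichlet integral `∫ |∇U|² < ∞` — a `D`-solution
candidate for Galdi's Liouville problem. Decay of `U` at infinity is NOT asserted (it does not
follow from core-window hypotheses). [folklore] -/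
theorem frozenCoreSteadyLimit {ν T M : ℝ}
    {u : ℝ → EuclideanSpace ℝ (Fin 3) → EuclideanSpace ℝ (Fin 3)}
    {p : ℝ → EuclideanSpace ℝ (Fin 3) → ℝ} {t : ℕ → ℝ} {ξ : ℕ → EuclideanSpace ℝ (Fin 3)}
    {lam : ℕ → ℝ} (hν : 0 < ν) (hu : IsClassicalNSSolutionOn (Ico 0 T) ν 0 u p)
    (h : IsQuasiSteadyCoreSequence ν T u t ξ lam M) :
    ∃ φ : ℕ → ℕ, StrictMono φ ∧ ∃ (U : EuclideanSpace ℝ (Fin 3) → EuclideanSpace ℝ (Fin 3))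
      (P : EuclideanSpace ℝ (Fin 3) → ℝ),
      IsLerayProfile ν 0 U P ∧ ContDiff ℝ (⊤ : ℕ∞) U ∧ ContDiff ℝ (⊤ : ℕ∞) P ∧ ‖U 0‖ = 1 ∧
      (∀ y, ‖U y‖ ≤ M * ν) ∧
      (∀ A : ℝ, TendstoUniformlyOn
        (fun j => coreProfile u (t (φ j)) (ξ (φ j)) (lam (φ j)) 0) U atTop (closedBall 0 A)) ∧
      (∀ A : ℝ, TendstoUniformlyOn
        (fun j => fderiv ℝ (coreProfile u (t (φ j)) (ξ (φ j)) (lam (φ j)) 0)) (fderiv ℝ U) atTop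
        (closedBall 0 A)) ∧
      (∀ A : ℝ, TendstoUniformlyOn
        (fun j => uncurry (coreProfile u (t (φ j)) (ξ (φ j)) (lam (φ j))))
        (fun z => U z.2) atTop (Icc (-A) 0 ×ˢ closedBall 0 A)) ∧
      (∀ A : ℝ, TendstoUniformlyOn
        (fun j => gradient (corePressure p (t (φ j)) (ξ (φ j)) (lam (φ j)) 0)) (gradient P) atTop
        (closedBall 0 A)) ∧
      (HasBoundedDirichletShare u t lam →
        ∫⁻ y, ENNReal.ofReal (frobeniusNormSq (fderiv ℝ U y)) < ⊤) := by
  obtain ⟨φ, hφ, U, P, hprof, hU0, hUb, hc0, hc1, hst, hgr⟩ := frozenCore_exists_steady_limit hu h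
  have hUs : ContDiff ℝ (⊤ : ℕ∞) U :=
    hprof.contDiff_velocity_infty hν.ne' (by simp)
  have hPs : ContDiff ℝ (⊤ : ℕ∞) P := hprof.contDiff_pressure_of_smooth hUs
  refine ⟨φ, hφ, U, P, hprof, hUs, hPs, hU0, hUb, hc0, hc1, hst, hgr, fun hD => ?_⟩
  obtain ⟨D, hDk⟩ := (hasBoundedDirichletShare_iff_core_fin3 ξ h.scale_pos).1 hD
  refine lt_of_le_of_lt (frozenCore_lintegral_frobeniusNormSq_le_of_tendsto
    (fun y => (hc1 ‖y‖).tendsto_at (mem_closedBall_zero_iff.2 le_rfl)) fun j => hDk (φ j)) ?_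
  exact ENNReal.coe_lt_top

/-- **Frozen core ⇒ nontrivial bounded smooth steady flow with finite Dirichlet integral**
(the `GaldiLiouville`-shaped corollary; recommended typed form of item stmt-0925): a classical
solution on `[0, T) × ℝ³` admitting a quasi-steady core sequence with bounded Dirichlet share
produces `U ≠ 0`, `P`, both smooth, with `IsLerayProfile ν 0 U P`, `∫ |∇U|² < ∞` and
`‖U‖ ≤ M ν`. Contrapositively, any Liouville theorem for bounded smooth steady solutions with
finite Dirichlet integral (Galdi's problem asks this under the extra decay `U → 0`) excludes
frozen cores with bounded Dirichlet share. [folklore] -/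
theorem frozenCoreSteadyLimit_dSolution {ν T M : ℝ}
    {u : ℝ → EuclideanSpace ℝ (Fin 3) → EuclideanSpace ℝ (Fin 3)}
    {p : ℝ → EuclideanSpace ℝ (Fin 3) → ℝ} {t : ℕ → ℝ} {ξ : ℕ → EuclideanSpace ℝ (Fin 3)}
    {lam : ℕ → ℝ} (hν : 0 < ν) (hu : IsClassicalNSSolutionOn (Ico 0 T) ν 0 u p)
    (h : IsQuasiSteadyCoreSequence ν T u t ξ lam M) (hD : HasBoundedDirichletShare u t lam) :
    ∃ (U : EuclideanSpace ℝ (Fin 3) → EuclideanSpace ℝ (Fin 3))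
      (P : EuclideanSpace ℝ (Fin 3) → ℝ),
      IsLerayProfile ν 0 U P ∧ ContDiff ℝ (⊤ : ℕ∞) U ∧ ContDiff ℝ (⊤ : ℕ∞) P ∧
      (∫⁻ y, ENNReal.ofReal (frobeniusNormSq (fderiv ℝ U y)) < ⊤) ∧ U ≠ 0 ∧
      ∀ y, ‖U y‖ ≤ M * ν := by
  obtain ⟨φ, -, U, P, hprof, hUs, hPs, hU0, hUb, -, -, -, -, hfin⟩ := frozenCoreSteadyLimit hν hu h
  refine ⟨U, P, hprof, hUs, hPs, hfin hD, fun hU => ?_, hUb⟩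
  rw [hU, Pi.zero_apply, norm_zero] at hU0
  exact zero_ne_one hU0

end SpaceDimThree

end Summit.NavierStokesRegularity.NavierStokesRegularity.Theorems

end
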